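import Literature.Computability.Complexity.AOWRandomLevels
import HarnessLib

/-!
# Failure probabilities of the level tests on `F_{OR_k}(n, p)` for fixed `n`
(Allen–O'Donnell–Witmer 2015, App. A.1–A.2: Markov on the trace, Chebyshev on `m`)

Trunk T-CPLX-CORE (Literature/Computability/Complexity). Support file for the discharge of the
named fact `allen_odonnell_witmer_kSAT` (`AOWRefutation.lean`), probabilistic part IX.

For the random constraint set `T ∼ subsetPMF (AOWConstraint k n) p` (`m̄ = 2^k n^k p`) we bound,
for FIXED `n`, the probability that one of the refuter's integer tests fails:

* `subsetProb_not_levelCheck_le` — a balanced level test (split `f : [a+b] ↪ [k]`, `1 ≤ b ≤ a` or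
  `b = 0 < a`... precisely `b ≤ a`, `1 ≤ a`, exponent `q = 2^j`):
  `P[¬LevelCheck] ≤ 4/m̄ + E-bound / θ`, `θ = (m̄/2)^{2q} / ((2^k)^{2q} (n^a)^q (n^b)^q)`, with the
  E-bound of `AOWWalkMoments` for `D = 2^k n^{k-b}`;
* `subsetProb_not_oddCheck_le` — the odd test (`k = 2r+1`, `f : [r+r+1] ↪ [k]`):
  `P[¬OddCheck] ≤ 4/m̄ + E_A-bound/θ_A + m̄/θ_w` with `θ_A = ((m̄/2)²)^{2q} / ((2·4^k n)^{2q} (n^{2r})^{2q})`,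
  `θ_w = (m̄/2)² / (2·4^k n)`, the E_A-bound of `AOWOddMoments` (regime `n^k p² ≥ 1`) and
  `E[∑ w²] ≤ m̄` (`subsetExp_sum_sq_randTensor_le`).

The asymptotics (`→ 0` under `m̄ ≥ C n^{k/2} (log n)^c`) are in `AOWSuccess.lean`.

## References

* S. R. Allen, R. O'Donnell, D. Witmer, *How to refute a random CSP*, FOCS 2015,
  arXiv:1505.04383, Fact 3.6, App. A.1, A.2 ("the Chernoff bound implies …"), A.4 (Claim: Markov).
-/

noncomputable section

namespace Literature.Computability.Complexity

open Finset Matrix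

variable {k n : ℕ}

/-! ### Second moments of centred fiber sums -/

/-- `E[(ξ_C - p)(ξ_{C'} - p)] = [C = C'] p(1-p)`. [folklore] -/
theorem subsetExp_centred_mul_centred {Λ : Type} [Fintype Λ] [DecidableEq Λ] {p : ℝ} (hp0 : 0 ≤ p)
    (hp1 : p ≤ 1) (x y : Λ) :
    subsetExp Λ p (fun T => (ind T x - p) * (ind T y - p)) = if x = y then p * (1 - p) else 0 := by
  have hpow1 : ∀ (T : Finset Λ) (i₀ : Λ),
      ∏ i', (ind T i' - p) ^ (if i' = i₀ then 1 else 0) = ind T i₀ - p := fun T i₀ => by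
    rw [Finset.prod_eq_single i₀ (fun i' _ hne => by rw [if_neg hne, pow_zero])
      (fun h => absurd (Finset.mem_univ _) h), if_pos rfl, pow_one]
  have h := subsetExp_prod_centred_pow hp0 hp1
    (fun i' => (if i' = x then 1 else 0) + if i' = y then 1 else 0)
  have hl : (fun T : Finset Λ => ∏ i',
      (ind T i' - p) ^ ((if i' = x then 1 else 0) + if i' = y then 1 else 0)) =
      fun T => (ind T x - p) * (ind T y - p) := by
    funext T
    simp only [pow_add, Finset.prod_mul_distrib, hpow1]
  rw [hl] at h
  rw [h]
  split_ifs with hxy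
  · subst hxy
    rw [Finset.prod_eq_single x (fun i' _ hne => by rw [if_neg hne, add_zero, bernMoment_zero])
      (fun h => absurd (Finset.mem_univ _) h), if_pos rfl]
    exact bernMoment_two p
  · exact Finset.prod_eq_zero (Finset.mem_univ x)
      (by rw [if_pos rfl, if_neg hxy, add_zero, bernMoment_one])

/-- **Second moment of a signed centred fiber sum**: `E[(∑_{C ∈ F} ε_C (ξ_C - p))²] ≤ |F| · p` for
`|ε| ≤ 1`. [Allen–O'Donnell–Witmer 2015, App. A.2 ("the Chernoff bound implies that its value is
at most `p n^{3k/2-1}`")] [folklore] -/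
theorem subsetExp_sq_fiberSum_le {Λ : Type} [Fintype Λ] [DecidableEq Λ] {p : ℝ} (hp0 : 0 ≤ p)
    (hp1 : p ≤ 1) (φ : Λ → Prop) [DecidablePred φ] (ε : Λ → ℝ) (hε : ∀ x, |ε x| ≤ 1) :
    subsetExp Λ p (fun T => (∑ x, if φ x then ε x * (ind T x - p) else 0) ^ 2) ≤
      ((univ.filter φ).card : ℝ) * p := by
  have hsq : ∀ T : Finset Λ, (∑ x, if φ x then ε x * (ind T x - p) else 0) ^ 2 =
      ∑ x, ∑ y, (if φ x then ε x else 0) * (if φ y then ε y else 0) *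
        ((ind T x - p) * (ind T y - p)) := by
    intro T
    rw [sq, Finset.sum_mul_sum]
    refine Finset.sum_congr rfl fun x _ => Finset.sum_congr rfl fun y _ => ?_
    split_ifs <;> ring
  simp_rw [hsq]
  rw [subsetExp_sum]
  simp_rw [subsetExp_sum, subsetExp_const_mul, subsetExp_centred_mul_centred hp0 hp1]
  have hinner : ∀ x, ∑ y, (if φ x then ε x else 0) * (if φ y then ε y else 0) *
      (if x = y then p * (1 - p) else 0) =
      (if φ x then ε x else 0) * (if φ x then ε x else 0) * (p * (1 - p)) := by
    intro x
    simp_rw [mul_ite, mul_zero]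
    rw [Finset.sum_ite_eq, if_pos (Finset.mem_univ x)]
  simp_rw [hinner]
  calc ∑ x, (if φ x then ε x else 0) * (if φ x then ε x else 0) * (p * (1 - p))
      ≤ ∑ x, (if φ x then (1 : ℝ) else 0) * p := by
        refine Finset.sum_le_sum fun x _ => ?_
        split_ifs
        · have h1 : ε x * ε x ≤ 1 := by
            have := hε x
            rw [abs_le] at this
            nlinarith
          have h4 : 0 ≤ p * (1 - p) := by nlinarith
          have h5 : p * (1 - p) ≤ p := by nlinarith
          nlinarith [mul_le_mul_of_nonneg_right h1 h4]
        · simp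
    _ = ((univ.filter φ).card : ℝ) * p := by
        rw [← Finset.sum_mul, Finset.sum_boole]

/-! ### The even level test -/

section Level

variable {a b : ℕ}

/-- The level matrix of the sample for the split `f`. [folklore] -/
def sampleLevelMatrix (f : Fin (a + b) → Fin k) (T : Finset (AOWConstraint k n)) :
    Matrix (Fin a → Fin n) (Fin b → Fin n) ℤ :=
  levelMatrix T.toList (univ.image f) (f ∘ Fin.castAdd b) (f ∘ Fin.natAdd a)

/-- The real trace of the level test on the sample. [folklore] -/
def levelTraceR (j : ℕ) (f : Fin (a + b) → Fin k) (T : Finset (AOWConstraint k n)) : ℝ :=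
  ((((sampleLevelMatrix f T).map (Int.cast : ℤ → ℝ))ᵀ * (sampleLevelMatrix f T).map (Int.cast : ℤ → ℝ)) ^
    2 ^ j).trace

/-- The real trace is the centred random fiber matrix's trace. [folklore] -/
theorem levelTraceR_eq (ha : 1 ≤ a) (j : ℕ) (f : Fin (a + b) → Fin k) (p : ℝ)
    (T : Finset (AOWConstraint k n)) :
    levelTraceR j f T =
      (((randFiberMatrix (fun C : AOWConstraint k n => C.1 ∘ (f ∘ Fin.castAdd b))
          (fun C => C.1 ∘ (f ∘ Fin.natAdd a)) (fun C => (C.signAt (univ.image f) : ℝ)) p T)ᵀ *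
        randFiberMatrix (fun C : AOWConstraint k n => C.1 ∘ (f ∘ Fin.castAdd b))
          (fun C => C.1 ∘ (f ∘ Fin.natAdd a)) (fun C => (C.signAt (univ.image f) : ℝ)) p T) ^
        2 ^ j).trace := by
  have hS : (univ.image f : Finset (Fin k)).Nonempty :=
    ⟨f ⟨0, by omega⟩, Finset.mem_image_of_mem _ (Finset.mem_univ _)⟩
  rw [levelTraceR, sampleLevelMatrix, levelMatrix_toList_map_cast T hS _ _ p]

/-- `0 ≤ levelTraceR`. [folklore] -/
theorem levelTraceR_nonneg (j : ℕ) (f : Fin (a + b) → Fin k) (T : Finset (AOWConstraint k n)) :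
    0 ≤ levelTraceR j f T :=
  trace_pow_two_pow_nonneg _ j

/-- **A failed level test means few constraints or a large trace.** [Allen–O'Donnell–Witmer 2015,
App. A.1] [folklore] -/
theorem not_levelCheck_imp (hn : 1 ≤ n) (j : ℕ) (f : Fin (a + b) → Fin k) {mbar : ℝ} (hmbar : 0 ≤ mbar)
    (T : Finset (AOWConstraint k n)) (h : ¬ LevelCheck k n j T.toList f) :
    (T.card : ℝ) < mbar / 2 ∨
      (mbar / 2) ^ (2 * 2 ^ j) /
          (((2 : ℝ) ^ k) ^ (2 * 2 ^ j) * (((n : ℝ) ^ a) ^ 2 ^ j * ((n : ℝ) ^ b) ^ 2 ^ j)) ≤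
        levelTraceR j f T := by
  by_cases hm : (T.card : ℝ) < mbar / 2
  · exact Or.inl hm
  · right
    push Not at hm
    have hK : 0 < ((2 : ℝ) ^ k) ^ (2 * 2 ^ j) * (((n : ℝ) ^ a) ^ 2 ^ j * ((n : ℝ) ^ b) ^ 2 ^ j) := by
      have : (0 : ℝ) < n := by exact_mod_cast hn
      positivity
    rw [div_le_iff₀ hK]
    -- the integer inequality, cast to `ℝ`
    unfold LevelCheck at h
    rw [not_lt, Finset.length_toList] at h
    have hR : ((T.card : ℝ)) ^ (2 * 2 ^ j) ≤
        ((2 : ℝ) ^ k) ^ (2 * 2 ^ j) * (((n : ℝ) ^ a) ^ 2 ^ j * ((n : ℝ) ^ b) ^ 2 ^ j * levelTraceR j f T) := by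
      rw [levelTraceR, sampleLevelMatrix, trace_pow_map_cast]
      exact_mod_cast h
    calc (mbar / 2) ^ (2 * 2 ^ j) ≤ (T.card : ℝ) ^ (2 * 2 ^ j) := pow_le_pow_left₀ (by positivity) hm _
      _ ≤ _ := hR
      _ = _ := by ring

/-- **Failure probability of a balanced level test** for fixed `n`:
`P[¬LevelCheck] ≤ 4/m̄ + (E-bound of the trace method)/θ`. [Allen–O'Donnell–Witmer 2015, App. A.1
and A.4 (Markov on the trace), Fact 3.6] [cite: arXiv150504383, App. A] -/
theorem subsetProb_not_levelCheck_le (hn : 1 ≤ n) (j : ℕ) (f : Fin (a + b) → Fin k)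
    (hf : Function.Injective f) (ha : 1 ≤ a) (hba : b ≤ a) {p : ℝ} (hp0 : 0 ≤ p) (hp1 : p ≤ 1)
    (hm : 0 < (Fintype.card (AOWConstraint k n) : ℝ) * p) :
    subsetProb (AOWConstraint k n) p (fun T => ¬ LevelCheck k n j T.toList f) ≤
      4 / (Fintype.card (AOWConstraint k n) * p) +
        (Fintype.card (AOWConstraint k n) * (((2 ^ j * 2 : ℕ)) : ℝ) ^ (2 ^ j * 2 - 1) * p *
            ((2 ^ j : ℕ) * max 1 ((p * ((n ^ (k - b) * 2 ^ k : ℕ) : ℝ)) ^ (2 ^ j - 1)))) /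
          ((Fintype.card (AOWConstraint k n) * p / 2) ^ (2 * 2 ^ j) /
            (((2 : ℝ) ^ k) ^ (2 * 2 ^ j) * (((n : ℝ) ^ a) ^ 2 ^ j * ((n : ℝ) ^ b) ^ 2 ^ j))) := by
  set mbar := (Fintype.card (AOWConstraint k n) : ℝ) * p with hmbar
  set θ := (mbar / 2) ^ (2 * 2 ^ j) /
    (((2 : ℝ) ^ k) ^ (2 * 2 ^ j) * (((n : ℝ) ^ a) ^ 2 ^ j * ((n : ℝ) ^ b) ^ 2 ^ j)) with hθ
  have hn0 : (0 : ℝ) < n := by exact_mod_cast hn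
  have hθpos : 0 < θ := by rw [hθ]; positivity
  -- split the failure event
  have hsplit := subsetProb_mono p (E := fun T => ¬ LevelCheck k n j T.toList f)
    (F := fun T => (T.card : ℝ) < mbar / 2 ∨ θ ≤ levelTraceR j f T)
    (fun T hT => not_levelCheck_imp hn j f (mbar := mbar) (by positivity) T hT)
  refine hsplit.trans ((subsetProb_or_le p _ _).trans (add_le_add ?_ ?_))
  · exact subsetProb_card_lt_half_le hp0 hp1 hm
  · -- Markov and the moment bound
    refine (subsetProb_le_subsetExp_div p (levelTraceR_nonneg j f) hθpos).trans ?_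
    refine div_le_div_of_nonneg_right ?_ hθpos.le
    rw [show (levelTraceR j f : Finset (AOWConstraint k n) → ℝ) = fun T => levelTraceR j f T from rfl]
    simp only [levelTraceR_eq ha j f p]
    have hq : 2 ^ j = (2 ^ j - 1) + 1 := (Nat.sub_add_cancel Nat.one_le_two_pow).symm
    -- fiber bounds with `D = 2^k n^{k-b}`
    have hrow : ∀ C : AOWConstraint k n, ((univ : Finset (AOWConstraint k n)).filter fun C' =>
        C'.1 ∘ (f ∘ Fin.castAdd b) = C.1 ∘ (f ∘ Fin.castAdd b)).card ≤ n ^ (k - b) * 2 ^ k := by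
      intro C
      rw [card_filter_constraint_comp_eq (hf.comp (Fin.castAdd_injective _ _)) C]
      exact Nat.mul_le_mul_right _ (Nat.pow_le_pow_right hn (by omega))
    have hcol : ∀ C : AOWConstraint k n, ((univ : Finset (AOWConstraint k n)).filter fun C' =>
        C'.1 ∘ (f ∘ Fin.natAdd a) = C.1 ∘ (f ∘ Fin.natAdd a)).card ≤ n ^ (k - b) * 2 ^ k := by
      intro C
      rw [card_filter_constraint_comp_eq (hf.comp (Fin.natAdd_injective _ _)) C]
    have hε : ∀ C : AOWConstraint k n, |(C.signAt (univ.image f) : ℝ)| ≤ 1 := fun C => by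
      rw [← Int.cast_abs, AOWConstraint.abs_signAt, Int.cast_one]
    have hmain := subsetExp_trace_pow_randFiberMatrix_le
      (fun C : AOWConstraint k n => C.1 ∘ (f ∘ Fin.castAdd b)) (fun C => C.1 ∘ (f ∘ Fin.natAdd a))
      (fun C => (C.signAt (univ.image f) : ℝ)) hε hrow hcol hp0 hp1 (2 ^ j - 1)
    have hcast : ((2 ^ j - 1 : ℕ) : ℝ) + 1 = ((2 ^ j : ℕ) : ℝ) := by
      rw [← Nat.cast_succ, Nat.succ_eq_add_one, ← hq]
    rw [← hq, hcast] at hmain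
    exact hmain

end Level

/-! ### The odd test -/

section Odd

variable {r : ℕ}

/-- The odd tensor of the sample, cast to `ℝ`. [folklore] -/
def sampleOddTensorR (f : Fin (r + r + 1) → Fin k) (T : Finset (AOWConstraint k n)) :
    (Fin r → Fin n) → (Fin r → Fin n) → Fin n → ℝ :=
  fun i i' l => (oddTensor T.toList (univ.image f) f i i' l : ℝ)

/-- The real trace of the odd test on the sample. [folklore] -/
def oddTraceR (j : ℕ) (f : Fin (r + r + 1) → Fin k) (T : Finset (AOWConstraint k n)) : ℝ :=
  ((((oddMatrix (oddTensor T.toList (univ.image f) f)).map (Int.cast : ℤ → ℝ))ᵀ *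
      (oddMatrix (oddTensor T.toList (univ.image f) f)).map (Int.cast : ℤ → ℝ)) ^ 2 ^ j).trace

/-- The real sum of squares of the odd tensor of the sample. [folklore] -/
def oddSqSumR (f : Fin (r + r + 1) → Fin k) (T : Finset (AOWConstraint k n)) : ℝ :=
  ∑ i, ∑ i', ∑ l, sampleOddTensorR f T i i' l ^ 2

/-- The sample odd tensor is the centred random tensor. [folklore] -/
theorem sampleOddTensorR_eq (f : Fin (r + r + 1) → Fin k) (p : ℝ)
    (T : Finset (AOWConstraint k n)) :
    sampleOddTensorR f T =
      randTensor (fun C : AOWConstraint k n => C.1 ∘ oddFst f) (fun C => C.1 ∘ oddSnd f)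
        (fun C => C.1 (oddLast f)) (fun C => (C.signAt (univ.image f) : ℝ)) p T := by
  have hS : (univ.image f : Finset (Fin k)).Nonempty :=
    ⟨f ⟨0, by omega⟩, Finset.mem_image_of_mem _ (Finset.mem_univ _)⟩
  exact oddTensor_toList_cast T hS f p

/-- The real odd trace is the trace of the ring-generic odd matrix of the random tensor. [folklore] -/
theorem oddTraceR_eq (j : ℕ) (f : Fin (r + r + 1) → Fin k) (p : ℝ)
    (T : Finset (AOWConstraint k n)) :
    oddTraceR j f T =
      (((oddMatrixOf (randTensor (fun C : AOWConstraint k n => C.1 ∘ oddFst f)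
          (fun C => C.1 ∘ oddSnd f) (fun C => C.1 (oddLast f))
          (fun C => (C.signAt (univ.image f) : ℝ)) p T))ᵀ *
        oddMatrixOf (randTensor (fun C : AOWConstraint k n => C.1 ∘ oddFst f)
          (fun C => C.1 ∘ oddSnd f) (fun C => C.1 (oddLast f))
          (fun C => (C.signAt (univ.image f) : ℝ)) p T)) ^ 2 ^ j).trace := by
  rw [oddTraceR, oddMatrix_map_cast, ← sampleOddTensorR_eq f p T]
  rfl

/-- `0 ≤ oddTraceR`. [folklore] -/
theorem oddTraceR_nonneg (j : ℕ) (f : Fin (r + r + 1) → Fin k) (T : Finset (AOWConstraint k n)) :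
    0 ≤ oddTraceR j f T :=
  trace_pow_two_pow_nonneg _ j

/-- `0 ≤ oddSqSumR`. [folklore] -/
theorem oddSqSumR_nonneg (f : Fin (r + r + 1) → Fin k) (T : Finset (AOWConstraint k n)) :
    0 ≤ oddSqSumR f T :=
  Finset.sum_nonneg fun _ _ => Finset.sum_nonneg fun _ _ => Finset.sum_nonneg fun _ _ => sq_nonneg _

/-- **`E[∑ w²] ≤ m̄`**: the expected sum of squares of the random tensor is at most the expected
number of constraints. [Allen–O'Donnell–Witmer 2015, App. A.2 ("at most `p n^{3k/2-1}`")] [cite: arXiv150504383, App. A.2] -/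
theorem subsetExp_oddSqSumR_le (f : Fin (r + r + 1) → Fin k) {p : ℝ} (hp0 : 0 ≤ p)
    (hp1 : p ≤ 1) :
    subsetExp (AOWConstraint k n) p (oddSqSumR f) ≤ Fintype.card (AOWConstraint k n) * p := by
  unfold oddSqSumR
  simp_rw [sampleOddTensorR_eq f p, subsetExp_sum]
  simp only [randTensor, tensorOf]
  have hε : ∀ C : AOWConstraint k n, |(C.signAt (univ.image f) : ℝ)| ≤ 1 := fun C => by
    rw [← Int.cast_abs, AOWConstraint.abs_signAt, Int.cast_one]
  calc _ ≤ ∑ i : Fin r → Fin n, ∑ i' : Fin r → Fin n, ∑ l : Fin n,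
        (((univ : Finset (AOWConstraint k n)).filter fun C =>
          OverTriple (fun C : AOWConstraint k n => C.1 ∘ oddFst f) (fun C => C.1 ∘ oddSnd f)
            (fun C => C.1 (oddLast f)) C (i, i', l)).card : ℝ) * p :=
        Finset.sum_le_sum fun i _ => Finset.sum_le_sum fun i' _ => Finset.sum_le_sum fun l _ =>
          subsetExp_sq_fiberSum_le hp0 hp1 _ _ hε
    _ = (∑ i : Fin r → Fin n, ∑ i' : Fin r → Fin n, ∑ l : Fin n,
        (((univ : Finset (AOWConstraint k n)).filter fun C =>
          OverTriple (fun C : AOWConstraint k n => C.1 ∘ oddFst f) (fun C => C.1 ∘ oddSnd f)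
            (fun C => C.1 (oddLast f)) C (i, i', l)).card : ℝ)) * p := by
        simp only [Finset.sum_mul]
    _ ≤ _ := by
        refine mul_le_mul_of_nonneg_right ?_ hp0
        -- the fibers over distinct triples are disjoint
        have hdisj : ∑ i : Fin r → Fin n, ∑ i' : Fin r → Fin n, ∑ l : Fin n,
            ((univ : Finset (AOWConstraint k n)).filter fun C =>
              OverTriple (fun C : AOWConstraint k n => C.1 ∘ oddFst f) (fun C => C.1 ∘ oddSnd f)
                (fun C => C.1 (oddLast f)) C (i, i', l)).card ≤ Fintype.card (AOWConstraint k n) := by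
          rw [← Finset.card_univ (α := AOWConstraint k n), Finset.card_eq_sum_card_fiberwise
            (f := fun C : AOWConstraint k n => (C.1 ∘ oddFst f, C.1 ∘ oddSnd f, C.1 (oddLast f)))
            (t := (univ : Finset ((Fin r → Fin n) × (Fin r → Fin n) × Fin n))) (fun _ _ => Finset.mem_univ _),
            Fintype.sum_prod_type, ]
          refine le_of_eq (Finset.sum_congr rfl fun i _ => ?_)
          rw [Fintype.sum_prod_type]
          refine Finset.sum_congr rfl fun i' _ => Finset.sum_congr rfl fun l _ => ?_
          congr 1
          ext C
          simp only [Finset.mem_filter, Finset.mem_univ, true_and, overTriple_iff]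
        exact_mod_cast hdisj

/-- **A failed odd test means few constraints, a large trace, or a large sum of squares.**
[Allen–O'Donnell–Witmer 2015, App. A.2] [folklore] -/
theorem not_oddCheck_imp (hn : 1 ≤ n) (j : ℕ) (f : Fin (r + r + 1) → Fin k) {mbar : ℝ}
    (hmbar : 0 ≤ mbar) (T : Finset (AOWConstraint k n)) (h : ¬ OddCheck k n j T.toList f) :
    (T.card : ℝ) < mbar / 2 ∨
      ((mbar / 2) ^ 2) ^ (2 * 2 ^ j) /
          ((2 * 4 ^ k * (n : ℝ)) ^ (2 * 2 ^ j) *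
            ((((n : ℝ) ^ r) ^ 2) ^ 2 ^ j * (((n : ℝ) ^ r) ^ 2) ^ 2 ^ j)) ≤ oddTraceR j f T ∨
      (mbar / 2) ^ 2 / (2 * 4 ^ k * (n : ℝ)) ≤ oddSqSumR f T := by
  by_cases hm : (T.card : ℝ) < mbar / 2
  · exact Or.inl hm
  · right
    push Not at hm
    have hn0 : (0 : ℝ) < n := by exact_mod_cast hn
    have hm2 : (mbar / 2) ^ 2 ≤ (T.card : ℝ) ^ 2 := pow_le_pow_left₀ (by positivity) hm 2
    unfold OddCheck at h
    rw [not_and_or, not_lt, not_lt, Finset.length_toList] at h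
    rcases h with h | h
    · left
      have hK : 0 < (2 * 4 ^ k * (n : ℝ)) ^ (2 * 2 ^ j) *
          ((((n : ℝ) ^ r) ^ 2) ^ 2 ^ j * (((n : ℝ) ^ r) ^ 2) ^ 2 ^ j) := by positivity
      rw [div_le_iff₀ hK]
      have hR : ((T.card : ℝ) ^ 2) ^ (2 * 2 ^ j) ≤
          (2 * 4 ^ k * (n : ℝ)) ^ (2 * 2 ^ j) *
            ((((n : ℝ) ^ r) ^ 2) ^ 2 ^ j * (((n : ℝ) ^ r) ^ 2) ^ 2 ^ j * oddTraceR j f T) := by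
        rw [oddTraceR, trace_pow_map_cast]
        exact_mod_cast h
      calc ((mbar / 2) ^ 2) ^ (2 * 2 ^ j) ≤ ((T.card : ℝ) ^ 2) ^ (2 * 2 ^ j) :=
            pow_le_pow_left₀ (by positivity) hm2 _
        _ ≤ _ := hR
        _ = _ := by ring
    · right
      have hK : 0 < 2 * 4 ^ k * (n : ℝ) := by positivity
      rw [div_le_iff₀ hK]
      have hR : (T.card : ℝ) ^ 2 ≤ 2 * 4 ^ k * (n : ℝ) * oddSqSumR f T := by
        unfold oddSqSumR sampleOddTensorR
        exact_mod_cast h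
      calc (mbar / 2) ^ 2 ≤ (T.card : ℝ) ^ 2 := hm2
        _ ≤ _ := hR
        _ = _ := by ring

/-- **Failure probability of the odd test** for fixed `n` (`k = 2r+1`, regime `n^k p² ≥ 1`):
`P[¬OddCheck] ≤ 4/m̄ + E_A-bound/θ_A + m̄/θ_w`. [Allen–O'Donnell–Witmer 2015, App. A.2, A.4
(Lemma A.2, Markov), Fact 3.6] [cite: arXiv150504383, App. A] -/
theorem subsetProb_not_oddCheck_le (hn : 1 ≤ n) (hk : k = r + r + 1) (j : ℕ) (f : Fin (r + r + 1) → Fin k)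
    (hf : Function.Injective f) {p : ℝ} (hp0 : 0 ≤ p) (hp1 : p ≤ 1)
    (hm : 0 < (Fintype.card (AOWConstraint k n) : ℝ) * p)
    (hreg : 1 ≤ ((n : ℝ) ^ r) ^ 2 * n * p ^ 2) :
    subsetProb (AOWConstraint k n) p (fun T => ¬ OddCheck k n j T.toList f) ≤
      4 / (Fintype.card (AOWConstraint k n) * p) +
        (((2 : ℝ) ^ k) ^ (2 ^ j * 2) * ((2 : ℝ) ^ k) ^ (2 ^ j * 2) *
            (((2 * 2 ^ j + 3) * 2 ^ j : ℕ) *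
              ((((2 ^ j * 4 : ℕ)) : ℝ) ^ (2 ^ j * 4 - 1) * (((2 ^ j * 2 : ℕ)) : ℝ) ^ (2 ^ j * 2 - 1)) *
                (((n : ℝ) ^ r) ^ 4 * (((n : ℝ) ^ r) ^ 2 * n * p ^ 2) ^ 2 ^ j))) /
          (((Fintype.card (AOWConstraint k n) * p / 2) ^ 2) ^ (2 * 2 ^ j) /
            ((2 * 4 ^ k * (n : ℝ)) ^ (2 * 2 ^ j) *
              ((((n : ℝ) ^ r) ^ 2) ^ 2 ^ j * (((n : ℝ) ^ r) ^ 2) ^ 2 ^ j))) +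
        (Fintype.card (AOWConstraint k n) * p) /
          ((Fintype.card (AOWConstraint k n) * p / 2) ^ 2 / (2 * 4 ^ k * (n : ℝ))) := by
  set mbar := (Fintype.card (AOWConstraint k n) : ℝ) * p with hmbar
  set θA := ((mbar / 2) ^ 2) ^ (2 * 2 ^ j) /
    ((2 * 4 ^ k * (n : ℝ)) ^ (2 * 2 ^ j) *
      ((((n : ℝ) ^ r) ^ 2) ^ 2 ^ j * (((n : ℝ) ^ r) ^ 2) ^ 2 ^ j)) with hθA
  set θw := (mbar / 2) ^ 2 / (2 * 4 ^ k * (n : ℝ)) with hθw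
  have hn0 : (0 : ℝ) < n := by exact_mod_cast hn
  have hθApos : 0 < θA := by rw [hθA]; positivity
  have hθwpos : 0 < θw := by rw [hθw]; positivity
  have hsplit := subsetProb_mono p (E := fun T => ¬ OddCheck k n j T.toList f)
    (F := fun T => ((T.card : ℝ) < mbar / 2 ∨ θA ≤ oddTraceR j f T) ∨ θw ≤ oddSqSumR f T)
    (fun T hT => by
      rcases not_oddCheck_imp hn j f (mbar := mbar) (by positivity) T hT with h | h | h
      · exact Or.inl (Or.inl h)
      · exact Or.inl (Or.inr h)
      · exact Or.inr h)
  refine hsplit.trans ((subsetProb_or_le p _ _).trans (add_le_add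
    ((subsetProb_or_le p _ _).trans (add_le_add ?_ ?_)) ?_))
  · exact subsetProb_card_lt_half_le hp0 hp1 hm
  · -- Markov and Lemma A.2
    refine (subsetProb_le_subsetExp_div p (oddTraceR_nonneg j f) hθApos).trans ?_
    refine div_le_div_of_nonneg_right ?_ hθApos.le
    rw [show (oddTraceR j f : Finset (AOWConstraint k n) → ℝ) = fun T => oddTraceR j f T from rfl]
    simp only [oddTraceR_eq j f p]
    have hq : 2 ^ j = (2 ^ j - 1) + 1 := (Nat.sub_add_cancel Nat.one_le_two_pow).symm
    have hε : ∀ C : AOWConstraint k n, |(C.signAt (univ.image f) : ℝ)| ≤ 1 := fun C => by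
      rw [← Int.cast_abs, AOWConstraint.abs_signAt, Int.cast_one]
    have hfib := card_filter_overTriple_le (n := n) f hf hk
    have hreg' : 1 ≤ (Fintype.card (Fin r → Fin n) : ℝ) ^ 2 * Fintype.card (Fin n) * p ^ 2 := by
      rwa [Fintype.card_fun, Fintype.card_fin, Fintype.card_fin, Nat.cast_pow]
    have hmain := subsetExp_trace_pow_oddMatrixOf_le
      (fun C : AOWConstraint k n => C.1 ∘ oddFst f) (fun C => C.1 ∘ oddSnd f) (fun C => C.1 (oddLast f))
      (fun C => (C.signAt (univ.image f) : ℝ)) hε hfib hp0 hp1 hreg' (2 ^ j - 1)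
    rw [← hq, Fintype.card_fun, Fintype.card_fin, Fintype.card_fin, Nat.cast_pow, Nat.cast_pow,
      Nat.cast_ofNat] at hmain
    exact hmain
  · -- Markov on the sum of squares
    refine (subsetProb_le_subsetExp_div p (oddSqSumR_nonneg f) hθwpos).trans ?_
    exact div_le_div_of_nonneg_right (subsetExp_oddSqSumR_le f hp0 hp1) hθwpos.le

end Odd

end Literature.Computability.Complexity
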